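import Literature.NumberTheory.ConnesConsani2021.SoninTraceReduction
import Literature.Analysis.OperatorTheory.L2KernelHilbertSchmidt
import Literature.NumberTheory.Automorphic.AutomorphicL2Separable
import Mathlib.MeasureTheory.Measure.SeparableMeasure
import HarnessLib

/-!
# Connes–Consani 2021, Prop. 2.2 (iii) "`Tr(ϑ(f)PP̂P) = L(f)`" — the OPERATOR HALF of its discharge:
# the trace side as the Hilbert–Schmidt norm of the factor `P̂Pϑ(g)`, and the socket for its `L²` kernel
# (proof-layer infrastructure: theorems only, 0 definitions, 0 named facts)

A. Connes, C. Consani, *Weil positivity and trace formula, the archimedean place*, Selecta Math. (N.S.)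
27 (2021) 77 = arXiv:2006.13771 [bib: `ConnesConsani2021`], §2 Prop. 2.2 (iii) (= arXiv Prop. 10 (iii),
p. 10): "`Tr(ϑ(f)PP̂P) = ∫₀^∞ f(ρ⁻¹)(δ(ρ) − τ(ρ))d*ρ`" (`= L(f) = W_∞(f) + D(f)`).  The tree types it,
for `f = g ∗ g*`, as the named fact `CC2021_prop_2_2_iii` (`SchwartzKernels.lean`): the supremum over
finite orthonormal families `(ξ_i)` of `P̂L²(ℝ)_ev = soninSpace 0 1` of `Σ_i Re⟨Pξ_i | ϑ(g ∗ g*) Pξ_i⟩`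
is `Re L(g ∗ g*)` — equivalently (`SchwartzKernelsHS.CC2021_prop_2_2_iii_iff_hasSum`) the convergence of
the Hilbert–Schmidt series `Σ_k ‖ϑ(g)† P b_k‖²` to `Re L(g ∗ g*)` along a Hilbert basis of `soninSpace 0 1`.
After the cell's reduction of Thm. 4.7 (`SoninTraceReduction.lean`, `ArchimedeanTraceFormulaProofs`) this
is the one remaining §2 input of the weak archimedean trace formula (cell ruling R45/R49), and the printed
proof (p. 10: kernels of `(1 − P)(uᵍ)P`, `ℓ_ρ(ν, μ)`, diagonal integration) is a KERNEL computation.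
This file is the operator half of that discharge (cell row R49, co-seat with t1):

* `hasSum_norm_sq_adjoint_scalingOp_outerProj_of_hasSum_cutoffs` — the trace side lives on ALL of
  `L²(ℝ)`: if `Σ_k ‖𝐏₀₁ 𝐏₁₀ ϑ(g) e_k‖² = L` along some Hilbert basis `(e_k)` of `L²(ℝ)`
  (`𝐏₁₀ = soninProjection 1 0 = P` and `𝐏₀₁ = soninProjection 0 1 = P̂` on even functions, both killing
  the odd part), then `Σ_j ‖ϑ(g)† P b_j‖² = L` along every Hilbert basis `(b_j)` of `soninSpace 0 1` — the
  converse of `SoninTraceReduction.hasSum_norm_sq_cutoffs_scalingOp_of_prop_2_2_iii`;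
* `prop_2_2_iii_of_hasSum_cutoffs` — hence `CC2021_prop_2_2_iii` follows from
  `Σ_k ‖𝐏₀₁ 𝐏₁₀ ϑ(g) e_k‖² = Re L(g ∗ g*)` (one Hilbert basis of `L²(ℝ)` per test function `g`);
* `hasSum_norm_sq_cutoffs_scalingOp_of_l2Kernel`, `prop_2_2_iii_of_l2Kernel(_self)` — **the kernel
  socket**: if, possibly after an isometry `U : L²(ℝ) → L²(X, μ)` (e.g. `U = 𝓕`, turning `P̂ = 𝓕⁻¹P𝓕` into
  `P`, or the passage to CC's multiplicative picture), the bounded operator `U 𝐏₀₁ 𝐏₁₀ ϑ(g)` acts a.e. by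
  a square-integrable kernel `k_g` (Reed–Simon I Thm. VI.23: `Σ_k ‖A e_k‖² = ∫∫ |k|²`, the tree's
  `L2Kernel.hasSum_norm_sq_op`), then `Σ_k ‖𝐏₀₁𝐏₁₀ϑ(g)e_k‖² = ∫∫ |k_g|²`, and `CC2021_prop_2_2_iii`
  follows from the KERNEL IDENTITY `∫∫ |k_g|² = Re L(g ∗ g*)` for every test function `g` — the content of
  the printed proof (the kernel half).

Label: RH-FREE operator bookkeeping at the archimedean place; bears_on W-C/W-P (the K1 boundary fact
`CC2021_prop_2_2_iii`); nothing here bears on the truth of RH.  Net debt delta 0.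

## References
* A. Connes, C. Consani, Selecta Math. (N.S.) 27 (2021) 77 = arXiv:2006.13771: Prop. 2.2 (iii) and its
  proof, p. 10 (chunk p0010:L20–L23, L28–L75). [ConnesConsani2021]
* M. Reed, B. Simon, *Methods of Modern Mathematical Physics I* (1972), Thm. VI.22 (d), Thm. VI.23
  (PDF pp. 198–199 of the held copy). [ReedSimon1972]
-/

noncomputable section

open _root_.MeasureTheory Complex Set Filter Function
open scoped Real ComplexConjugate ENNReal InnerProductSpace Topology

namespace Literature.NumberTheory.ConnesConsani2021

open Literature.NumberTheory.LFunctions Literature.Analysis.OperatorTheory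

variable {g : ℝ → ℂ}

/-- `(𝐏₁₀ ϑ(g))† = ϑ(g)† 𝐏₁₀` (`𝐏₁₀` is an orthogonal projection). [cite: ConnesConsani2021, Prop. 2.2 (iii) p. 10] -/
theorem adjoint_soninProjection_comp_scalingOp (g : ℝ → ℂ) :
    ContinuousLinearMap.adjoint (soninProjection 1 0 ∘L scalingOp g) =
      ContinuousLinearMap.adjoint (scalingOp g) ∘L soninProjection 1 0 := by
  rw [ContinuousLinearMap.adjoint_comp]
  congr 1
  exact (isSelfAdjoint_starProjection (soninSpace 1 0)).adjoint_eq

/-- **The trace side of Prop. 2.2 (iii) lives on all of `L²(ℝ)`.**  If `Σ_k ‖𝐏₀₁ 𝐏₁₀ ϑ(g) e_k‖² = L` along a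
Hilbert basis `(e_k)` of `L²(ℝ)`, then `Σ_j ‖ϑ(g)† P b_j‖² = L` along every Hilbert basis `(b_j)` of
`P̂L²(ℝ)_ev = soninSpace 0 1` (`Σ_k ‖𝐏_V R e_k‖² = Σ_j ‖R† b_j‖²` with `V = soninSpace 0 1`,
`R = 𝐏₁₀ϑ(g)`, `R† = ϑ(g)†𝐏₁₀`, and `𝐏₁₀ b_j = P b_j` for the even `b_j`).
[cite: ConnesConsani2021, Prop. 2.2 (iii) p. 10 (chunk p0010:L20–L23)] [cite: ReedSimon1972, Thm. VI.22 (d), PDF p. 198] -/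
theorem hasSum_norm_sq_adjoint_scalingOp_outerProj_of_hasSum_cutoffs {κ ι : Type*}
    {e : HilbertBasis κ ℂ (Lp ℂ 2 (volume : Measure ℝ))} {L : ℝ}
    (h : HasSum (fun k => ‖soninProjection 0 1 (soninProjection 1 0 (scalingOp g (e k)))‖ ^ 2) L)
    (b : HilbertBasis ι ℂ (soninSpace 0 1)) :
    HasSum (fun j => ‖ContinuousLinearMap.adjoint (scalingOp g)
        (outerProj ((b j : soninSpace 0 1) : Lp ℂ 2 (volume : Measure ℝ)))‖ ^ 2) L := by
  have h1 := (hasSum_norm_sq_starProjection_apply_iff (V := soninSpace 0 1) b e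
    (soninProjection 1 0 ∘L scalingOp g) (L := L)).1 h
  rw [adjoint_soninProjection_comp_scalingOp] at h1
  refine h1.congr_fun fun j => ?_
  rw [ContinuousLinearMap.comp_apply, soninProjection_one_zero_eq_outerProj
    (soninSpace_le_evenPart 0 1 (Submodule.coe_mem (b j)))]

/-- **`CC2021_prop_2_2_iii` from the Hilbert–Schmidt series on `L²(ℝ)`**: if for every test function `g`
some Hilbert basis `(e_k)` of `L²(ℝ)` has `Σ_k ‖𝐏₀₁ 𝐏₁₀ ϑ(g) e_k‖² = Re L(g ∗ g*)`, then Prop. 2.2 (iii)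
holds in the tree's typing (through `SchwartzKernelsHS.prop_2_2_iii_of_hasSum`).
[cite: ConnesConsani2021, Prop. 2.2 (iii) p. 10 (chunk p0010:L20–L23)] -/
theorem prop_2_2_iii_of_hasSum_cutoffs
    (H : ∀ g : ℝ → ℂ, IsWeilTest g →
      ∃ (κ : Type) (e : HilbertBasis κ ℂ (Lp ℂ 2 (volume : Measure ℝ))),
        HasSum (fun k => ‖soninProjection 0 1 (soninProjection 1 0 (scalingOp g (e k)))‖ ^ 2)
          (traceL (weilConv g (weilReflect g))).re) :
    CC2021_prop_2_2_iii := by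
  refine prop_2_2_iii_of_hasSum fun g hg => ?_
  obtain ⟨κ, e, he⟩ := H g hg
  obtain ⟨w, b, -⟩ := exists_hilbertBasis ℂ (soninSpace 0 1)
  exact ⟨w, b, hasSum_norm_sq_adjoint_scalingOp_outerProj_of_hasSum_cutoffs he b⟩

/-! ## The kernel socket: `P̂Pϑ(g)` (or a unitary image of it) as an `L²`-kernel operator -/

/-- **The Hilbert–Schmidt series of `P̂Pϑ(g)` from an `L²` kernel** (Reed–Simon I, Thm. VI.23): if, after
an isometry `U : L²(ℝ) → L²(X, μ)` (e.g. `U = 1`, or `U = 𝓕`, which turns `P̂ = 𝓕⁻¹P𝓕` into `P`), the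
bounded operator `U 𝐏₀₁ 𝐏₁₀ ϑ(g)` acts a.e. by a kernel `k ∈ L²(μ ⊗ dx)`, then along every countable
Hilbert basis `(e_i)` of `L²(ℝ)`, `Σ_i ‖𝐏₀₁ 𝐏₁₀ ϑ(g) e_i‖² = ∫_X ∫_ℝ |k(x, y)|² dy dμ(x)`.
[cite: ConnesConsani2021, Prop. 2.2 (iii) p. 10 (proof, chunk p0010:L28–L75)] [cite: ReedSimon1972, Thm. VI.23, PDF pp. 198–199] -/
theorem hasSum_norm_sq_cutoffs_scalingOp_of_l2Kernel {X : Type*} [MeasurableSpace X] {μ : Measure X}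
    [SFinite μ] (U : Lp ℂ 2 (volume : Measure ℝ) →ₗᵢ[ℂ] Lp ℂ 2 μ) {k : X → ℝ → ℂ}
    (hk : MemLp (uncurry k) 2 (μ.prod (volume : Measure ℝ)))
    (hB : ∀ φ : Lp ℂ 2 (volume : Measure ℝ),
      ((U (soninProjection 0 1 (soninProjection 1 0 (scalingOp g φ))) : Lp ℂ 2 μ) : X → ℂ) =ᵐ[μ]
        fun x => ∫ y, k x y * φ y)
    {κ : Type*} [Countable κ] (e : HilbertBasis κ ℂ (Lp ℂ 2 (volume : Measure ℝ))) :
    HasSum (fun i => ‖soninProjection 0 1 (soninProjection 1 0 (scalingOp g (e i)))‖ ^ 2)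
      (∫ x, ∫ y, ‖k x y‖ ^ 2 ∂volume ∂μ) := by
  have h := L2Kernel.hasSum_norm_sq_op (μ := μ) (ν := (volume : Measure ℝ)) hk
    (A := U.toContinuousLinearMap ∘L soninProjection 0 1 ∘L soninProjection 1 0 ∘L scalingOp g)
    (fun φ => by
      simpa only [ContinuousLinearMap.comp_apply, LinearIsometry.coe_toContinuousLinearMap] using hB φ) e
  simpa only [ContinuousLinearMap.comp_apply, LinearIsometry.coe_toContinuousLinearMap,
    LinearIsometry.norm_map] using h

/-- **Prop. 2.2 (iii) from the KERNEL IDENTITY** — the socket for the printed proof (p. 10): if for every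
test function `g` there are an isometry `U : L²(ℝ) → L²(X, μ)` into the `L²` space of some s-finite measure
space and a square-integrable kernel `k_g` on `X × ℝ` such that `U P̂Pϑ(g) = U 𝐏₀₁ 𝐏₁₀ ϑ(g)` acts a.e. by
`k_g` and `∫_X ∫_ℝ |k_g(x, y)|² dy dμ(x) = Re L(g ∗ g*)` (`traceL = archW + remainderD`), then
`CC2021_prop_2_2_iii` holds.  (Typical use: `X = ℝ`, `U = 𝓕`, `k_g(ξ, y)` the kernel of `P𝓕Pϑ(g)` on even
functions; a Hilbert basis of `L²(ℝ)` has a countable index since `L²(ℝ)` is separable.)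
[cite: ConnesConsani2021, Prop. 2.2 (iii) p. 10 (statement and proof, chunk p0010:L20–L75)] [cite: ReedSimon1972, Thm. VI.23, PDF pp. 198–199] -/
theorem prop_2_2_iii_of_l2Kernel
    (H : ∀ g : ℝ → ℂ, IsWeilTest g →
      ∃ (X : Type) (_ : MeasurableSpace X) (μ : Measure X) (_ : SFinite μ)
        (U : Lp ℂ 2 (volume : Measure ℝ) →ₗᵢ[ℂ] Lp ℂ 2 μ) (k : X → ℝ → ℂ),
        MemLp (uncurry k) 2 (μ.prod (volume : Measure ℝ)) ∧
        (∀ φ : Lp ℂ 2 (volume : Measure ℝ),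
          ((U (soninProjection 0 1 (soninProjection 1 0 (scalingOp g φ))) : Lp ℂ 2 μ) : X → ℂ) =ᵐ[μ]
            fun x => ∫ y, k x y * φ y) ∧
        ∫ x, ∫ y, ‖k x y‖ ^ 2 ∂volume ∂μ = (traceL (weilConv g (weilReflect g))).re) :
    CC2021_prop_2_2_iii := by
  refine prop_2_2_iii_of_hasSum_cutoffs fun g hg => ?_
  obtain ⟨X, _, μ, _, U, k, hk, hB, hL⟩ := H g hg
  obtain ⟨w, e, -⟩ := exists_hilbertBasis ℂ (Lp ℂ 2 (volume : Measure ℝ))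
  haveI : Fact ((2 : ℝ≥0∞) ≠ ∞) := ⟨ENNReal.ofNat_ne_top⟩
  haveI : Countable w := HilbertBasis.countable_index_of_separableSpace e
  refine ⟨w, e, ?_⟩
  rw [← hL]
  exact hasSum_norm_sq_cutoffs_scalingOp_of_l2Kernel U hk hB e

/-- The same socket with no isometry (`X = ℝ`, `U = 1`): an `L²(ℝ × ℝ)` kernel for `P̂Pϑ(g) = 𝐏₀₁𝐏₁₀ϑ(g)`
itself with `∫∫ |k_g|² = Re L(g ∗ g*)` for every test function `g` gives `CC2021_prop_2_2_iii`.
[cite: ConnesConsani2021, Prop. 2.2 (iii) p. 10 (chunk p0010:L20–L75)] [cite: ReedSimon1972, Thm. VI.23, PDF pp. 198–199] -/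
theorem prop_2_2_iii_of_l2Kernel_self
    (H : ∀ g : ℝ → ℂ, IsWeilTest g → ∃ k : ℝ → ℝ → ℂ,
      MemLp (uncurry k) 2 ((volume : Measure ℝ).prod volume) ∧
      (∀ φ : Lp ℂ 2 (volume : Measure ℝ),
        ((soninProjection 0 1 (soninProjection 1 0 (scalingOp g φ)) : Lp ℂ 2 (volume : Measure ℝ)) :
            ℝ → ℂ) =ᵐ[volume] fun x => ∫ y, k x y * φ y) ∧
      ∫ x, ∫ y, ‖k x y‖ ^ 2 = (traceL (weilConv g (weilReflect g))).re) :
    CC2021_prop_2_2_iii := by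
  refine prop_2_2_iii_of_l2Kernel fun g hg => ?_
  obtain ⟨k, hk, hB, hL⟩ := H g hg
  exact ⟨ℝ, inferInstance, volume, inferInstance, LinearIsometry.id, k, hk,
    fun φ => by simpa only [LinearIsometry.id_apply] using hB φ, hL⟩

end Literature.NumberTheory.ConnesConsani2021

end
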